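import Literature.MathematicalPhysics.QuantumManyBody.BosonicSectorBasis
import HarnessLib

/-!
# The excitation map `U_N` of Lewin–Nam–Serfaty–Solovej in the occupation basis and its rules (2.4)

Topic `Literature/MathematicalPhysics/QuantumManyBody`, namespace `BoseGas.Fock`; sequel of
`TruncatedFockSpace.lean` (`FockSpace ι = ℓ²(ι →₀ ℕ)`, `truncFock`, `numberCLM`, `bAnnih`, `bCreate`,
`crAnOp`) and `BosonicSectorBasis.lean` (the `N`-boson sector). Written for the provefact
`Literature.MathematicalPhysics.QuantumManyBody.BoseGas.BoccatoEtAl2019Acta_firstExcitation`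
([BoccatoEtAl2019Acta, Thm. 1.1]); the object of this file is the unitary
`U_N : L²_s(Λ^N) → 𝓕_+^{≤N}` of [ibid., §1 and §2], due to Lewin–Nam–Serfaty–Solovej, which "factors
out the condensate", in the momentum (occupation-number) picture.

**In the occupation basis `U_N` is a relabelling.** The `N`-boson sector over ALL modes `ι`
(condensate mode `z ∈ ι` included) is spanned by the `|d⟩`, `d : ι →₀ ℕ`, `|d| = N`; the truncated
excitation Fock space `𝓕_+^{≤N}` over the modes `ι₊ = {p // p ≠ z}` by the `|dp⟩`, `|dp| ≤ N`; and
`ψ_N = ∑_n α^{(n)} ⊗_s φ_z^{⊗(N-n)} ↦ U_N ψ_N = (α^{(n)})_n` reads `|d⟩ ↦ |d restricted to ι₊⟩`, with inverse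
`dp ↦ dp + (N - |dp|) e_z` (`dropConfig`, `liftConfig`). Accordingly
* `excitationMap z N : FockSpace ι →L[ℂ] FockSpace ι₊` — `(U_N ξ)(dp) = ξ(liftConfig dp)` for `|dp| ≤ N`
  (zero above): a partial isometry, isometric on the `N`-boson sector `sectorFock ι N`, with values in
  `𝓕_+^{≤N}`; its adjoint `excitationMapAdj` (`(U_N^* η)(d) = η(dropConfig d)` for `|d| = N`);
  `U_N^* U_N = 1` on the sector and `U_N U_N^* = 1` on `𝓕_+^{≤N}`;
* **the rules** [BoccatoEtAl2019Acta, (2.4)] on the `N`-boson sector: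
  `U_N a_z^* a_z = (N - 𝒩_+) U_N`, `U_N a_p^* a_z = √N b_p^* U_N`, `U_N a_z^* a_p = √N b_p U_N`,
  `U_N a_p^* a_q = a_p^* a_q U_N` (`p, q ≠ z`).

## References
* [BoccatoEtAl2019Acta] Boccato–Brennecke–Cenatiempo–Schlein, Acta Math. 222 (2019), §1–2, (2.4).
* M. Lewin, P. T. Nam, S. Serfaty, J. P. Solovej, *Bogoliubov spectrum of interacting Bose gases*,
  Comm. Pure Appl. Math. 68 (2015), §4 (the map `U_N`), cited in [BoccatoEtAl2019Acta] as [LNSS].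
-/

noncomputable section

open Filter Set Function Finset
open scoped ENNReal NNReal ComplexConjugate InnerProductSpace BigOperators

namespace Literature.MathematicalPhysics.QuantumManyBody.BoseGas.Fock

variable {ι : Type*} (z : ι) (N : ℕ)

/-! ### Configurations with and without the condensate mode -/

/-- The excitation modes: all modes except the condensate mode `z`. [cite: BoccatoEtAl2019Acta, §2 (`Λ*₊`)] -/
abbrev ExcMode (z : ι) : Type _ := {p : ι // p ≠ z}

/-- Drop the condensate: the excitation part `d|_{ι₊}` of a configuration. [cite: BoccatoEtAl2019Acta, §2] -/
def dropConfig (d : ι →₀ ℕ) : ExcMode z →₀ ℕ := d.subtypeDomain fun p => p ≠ z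

/-- Fill up the condensate: `dp ↦ dp + (N - |dp|) e_z`. [cite: BoccatoEtAl2019Acta, §2] -/
def liftConfig (dp : ExcMode z →₀ ℕ) : ι →₀ ℕ :=
  dp.mapDomain Subtype.val + Finsupp.single z (N - dp.degree)

variable {z N}

/-- `(dropConfig d) p = d p`. [folklore] -/
@[simp] theorem dropConfig_apply (d : ι →₀ ℕ) (p : ExcMode z) : dropConfig z d p = d p := rfl

/-- `dropConfig` is additive. [folklore] -/
theorem dropConfig_add (d e : ι →₀ ℕ) : dropConfig z (d + e) = dropConfig z d + dropConfig z e :=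
  Finsupp.subtypeDomain_add

/-- The excitation part of `e_z` vanishes. [folklore] -/
theorem dropConfig_single_zero (n : ℕ) : dropConfig z (Finsupp.single z n) = 0 := by
  ext p; rw [dropConfig_apply, Finsupp.single_eq_of_ne p.2]; rfl

/-- The excitation part of `e_p`, `p ≠ z`. [folklore] -/
theorem dropConfig_single (p : ExcMode z) (n : ℕ) :
    dropConfig z (Finsupp.single (p : ι) n) = Finsupp.single p n := by
  classical
  ext q
  rw [dropConfig_apply, Finsupp.single_apply, Finsupp.single_apply]
  simp only [Subtype.val_inj]

/-- The embedded excitation part at an excitation mode. [folklore] -/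
theorem mapDomain_val_apply (dp : ExcMode z →₀ ℕ) (p : ExcMode z) :
    (dp.mapDomain Subtype.val : ι →₀ ℕ) p = dp p :=
  Finsupp.mapDomain_apply Subtype.val_injective dp p

/-- The embedded excitation part vanishes at the condensate mode. [folklore] -/
theorem mapDomain_val_apply_zero (dp : ExcMode z →₀ ℕ) : (dp.mapDomain Subtype.val : ι →₀ ℕ) z = 0 :=
  Finsupp.mapDomain_notin_range _ _ (by rintro ⟨p, hp⟩; exact p.2 hp)

/-- `(liftConfig dp) p = dp p` at an excitation mode. [folklore] -/
theorem liftConfig_apply_exc (dp : ExcMode z →₀ ℕ) (p : ExcMode z) : liftConfig z N dp p = dp p := by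
  rw [liftConfig, Finsupp.add_apply, mapDomain_val_apply, Finsupp.single_eq_of_ne p.2, add_zero]

/-- `(liftConfig dp) z = N - |dp|`. [folklore] -/
theorem liftConfig_apply_zero (dp : ExcMode z →₀ ℕ) : liftConfig z N dp z = N - dp.degree := by
  rw [liftConfig, Finsupp.add_apply, mapDomain_val_apply_zero, Finsupp.single_eq_same, zero_add]

/-- `dropConfig ∘ liftConfig = id`. [folklore] -/
@[simp] theorem dropConfig_liftConfig (dp : ExcMode z →₀ ℕ) : dropConfig z (liftConfig z N dp) = dp := by
  ext p
  rw [dropConfig_apply, liftConfig_apply_exc]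

/-- A configuration is its embedded excitation part plus its condensate part. [folklore] -/
theorem mapDomain_val_dropConfig_add (d : ι →₀ ℕ) :
    (dropConfig z d).mapDomain Subtype.val + Finsupp.single z (d z) = d := by
  ext p
  rw [Finsupp.add_apply]
  by_cases hp : p = z
  · subst hp
    rw [mapDomain_val_apply_zero, Finsupp.single_eq_same, zero_add]
  · rw [Finsupp.single_eq_of_ne hp, add_zero]
    exact mapDomain_val_apply (dropConfig z d) ⟨p, hp⟩

/-- The degree of the excitation part: `|dropConfig d| + d z = |d|`. [folklore] -/
theorem degree_dropConfig_add (d : ι →₀ ℕ) : (dropConfig z d).degree + d z = d.degree := by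
  conv_rhs => rw [← mapDomain_val_dropConfig_add (z := z) d]
  rw [map_add, Finsupp.degree_mapDomain, Finsupp.degree_single]

/-- The lift of a configuration with at most `N` particles has exactly `N` particles. [folklore] -/
theorem degree_liftConfig {dp : ExcMode z →₀ ℕ} (h : dp.degree ≤ N) : (liftConfig z N dp).degree = N := by
  rw [liftConfig, map_add, Finsupp.degree_mapDomain, Finsupp.degree_single]
  omega

/-- `liftConfig ∘ dropConfig = id` on configurations with `N` particles. [folklore] -/
theorem liftConfig_dropConfig {d : ι →₀ ℕ} (hd : d.degree = N) : liftConfig z N (dropConfig z d) = d := by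
  have h := degree_dropConfig_add (z := z) d
  rw [liftConfig, show N - (dropConfig z d).degree = d z by omega]
  exact mapDomain_val_dropConfig_add d

/-- The excitation part of an `N`-particle configuration has at most `N` particles. [folklore] -/
theorem degree_dropConfig_le {d : ι →₀ ℕ} (hd : d.degree = N) : (dropConfig z d).degree ≤ N := by
  have h := degree_dropConfig_add (z := z) d; omega

/-- `liftConfig` is injective on `{|dp| ≤ N}`. [folklore] -/
theorem liftConfig_injOn : InjOn (liftConfig z N) {dp : ExcMode z →₀ ℕ | dp.degree ≤ N} :=
  fun dp _ ep _ h => by rw [← dropConfig_liftConfig (N := N) dp, h, dropConfig_liftConfig]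

/-- `dropConfig` is injective on `{|d| = N}`. [folklore] -/
theorem dropConfig_injOn : InjOn (dropConfig z) {d : ι →₀ ℕ | d.degree = N} :=
  fun d hd e he h => by rw [← liftConfig_dropConfig (z := z) hd, h, liftConfig_dropConfig he]

/-- `liftConfig (dp + e_p) = liftConfig dp - e_z + e_p` (`p ≠ z`; both sides have `N - |dp| - 1` particles in
the condensate, truncated at `0`). [folklore] -/
theorem liftConfig_add_single (dp : ExcMode z →₀ ℕ) (p : ExcMode z) :
    liftConfig z N (dp + Finsupp.single p 1) =
      liftConfig z N dp - Finsupp.single z 1 + Finsupp.single (p : ι) 1 := by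
  ext q
  rw [Finsupp.add_apply, Finsupp.tsub_apply]
  by_cases hq : q = z
  · rw [hq, liftConfig_apply_zero, liftConfig_apply_zero, Finsupp.single_eq_same,
      Finsupp.single_eq_of_ne (Ne.symm p.2), map_add, Finsupp.degree_single]
    omega
  · have e1 := liftConfig_apply_exc (N := N) (dp + Finsupp.single p 1) ⟨q, hq⟩
    have e2 := liftConfig_apply_exc (N := N) dp ⟨q, hq⟩
    rw [e1, e2, Finsupp.single_eq_of_ne hq, Finsupp.add_apply]
    by_cases hpq : (p : ι) = q
    · have hp' : p = ⟨q, hq⟩ := Subtype.ext hpq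
      rw [hp', Finsupp.single_eq_same]
      rw [show ((⟨q, hq⟩ : ExcMode z) : ι) = q from rfl, Finsupp.single_eq_same]
      omega
    · rw [Finsupp.single_eq_of_ne (fun h : (⟨q, hq⟩ : ExcMode z) = p => hpq (by rw [← h])),
        Finsupp.single_eq_of_ne (Ne.symm hpq)]
      omega

/-! ### Bounded relabellings between Fock spaces over different mode sets -/

section CrossShift

variable {α β : Type*} (w : β → ℂ) (σ : β → α)

/-- Square summability of a weighted relabelled amplitude across index types: if `σ : β → α` is
injective where `w ≠ 0` and `|w| ≤ C` then `∑_b |w(b) ξ(σ b)|² ≤ C² ‖ξ‖²`. [folklore] -/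
theorem tsum_sq_crossShift_le (hσ : InjOn σ {b | w b ≠ 0}) {C : ℝ} (hw : ∀ b, ‖w b‖ ≤ C)
    (ξ : lp (fun _ : α => ℂ) 2) :
    Summable (fun b => ‖w b * ξ (σ b)‖ ^ 2) ∧ ∑' b, ‖w b * ξ (σ b)‖ ^ 2 ≤ C ^ 2 * ‖ξ‖ ^ 2 := by
  classical
  set S : Set β := {b | w b ≠ 0} with hS
  have hξ : Summable fun a => ‖ξ a‖ ^ 2 := by
    have h := lp.memℓp ξ
    rw [memℓp_gen_iff two_toReal_pos] at h
    simpa [Real.rpow_two] using h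
  have hnorm : ‖ξ‖ ^ 2 = ∑' a, ‖ξ a‖ ^ 2 := by
    have h := lp.norm_rpow_eq_tsum two_toReal_pos ξ
    simpa [Real.rpow_two] using h
  have hinj : Injective (fun b : S => σ b) := fun a b h => Subtype.ext (hσ a.2 b.2 h)
  have h1 : Summable fun b : S => ‖ξ (σ b)‖ ^ 2 := hξ.comp_injective hinj
  have hle1 : ∑' b : S, ‖ξ (σ b)‖ ^ 2 ≤ ∑' a, ‖ξ a‖ ^ 2 :=
    tsum_comp_le_tsum_of_inj hξ (fun _ => by positivity) hinj
  have hvan : ∀ b, b ∉ S → ‖w b * ξ (σ b)‖ ^ 2 = 0 := fun b hb => by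
    simp only [hS, mem_setOf_eq, not_not] at hb
    simp [hb]
  have hbound : ∀ b : S, ‖w b * ξ (σ b)‖ ^ 2 ≤ C ^ 2 * ‖ξ (σ b)‖ ^ 2 := fun b => by
    rw [norm_mul, mul_pow]
    exact mul_le_mul_of_nonneg_right (pow_le_pow_left₀ (norm_nonneg _) (hw b) 2) (by positivity)
  have h2 : Summable fun b : S => ‖w b * ξ (σ b)‖ ^ 2 :=
    (h1.mul_left (C ^ 2)).of_nonneg_of_le (fun _ => by positivity) hbound
  have hind : S.indicator (fun b => ‖w b * ξ (σ b)‖ ^ 2) = fun b => ‖w b * ξ (σ b)‖ ^ 2 := by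
    funext b
    by_cases hb : b ∈ S
    · rw [indicator_of_mem hb]
    · rw [indicator_of_notMem hb, hvan b hb]
  have h3 : Summable fun b => ‖w b * ξ (σ b)‖ ^ 2 := by
    rw [← hind]; exact summable_subtype_iff_indicator.1 h2
  refine ⟨h3, ?_⟩
  calc ∑' b, ‖w b * ξ (σ b)‖ ^ 2 = ∑' b, S.indicator (fun b => ‖w b * ξ (σ b)‖ ^ 2) b := by rw [hind]
    _ = ∑' b : S, ‖w b * ξ (σ b)‖ ^ 2 := (tsum_subtype S _).symm
    _ ≤ ∑' b : S, C ^ 2 * ‖ξ (σ b)‖ ^ 2 := h2.tsum_le_tsum hbound (h1.mul_left _)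
    _ = C ^ 2 * ∑' b : S, ‖ξ (σ b)‖ ^ 2 := tsum_mul_left
    _ ≤ C ^ 2 * ∑' a, ‖ξ a‖ ^ 2 := by gcongr
    _ = C ^ 2 * ‖ξ‖ ^ 2 := by rw [hnorm]

/-- The relabelled weighted amplitude is square summable. [folklore] -/
theorem memℓp_crossShift (hσ : InjOn σ {b | w b ≠ 0}) {C : ℝ} (hw : ∀ b, ‖w b‖ ≤ C)
    (ξ : lp (fun _ : α => ℂ) 2) : Memℓp (fun b => w b * ξ (σ b)) 2 := by
  rw [memℓp_gen_iff two_toReal_pos]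
  simpa [Real.rpow_two] using (tsum_sq_crossShift_le w σ hσ hw ξ).1

/-- **Weighted relabellings between `ℓ²` spaces are bounded** (see `crossShift`): the linear map. [folklore] -/
def crossShiftₗ (hσ : InjOn σ {b | w b ≠ 0}) {C : ℝ} (hw : ∀ b, ‖w b‖ ≤ C) :
    lp (fun _ : α => ℂ) 2 →ₗ[ℂ] lp (fun _ : β => ℂ) 2 where
  toFun ξ := ⟨fun b => w b * ξ (σ b), memℓp_crossShift w σ hσ hw ξ⟩
  map_add' ξ η := by
    ext b
    show w b * (ξ + η) (σ b) = w b * ξ (σ b) + w b * η (σ b)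
    rw [lp.coeFn_add, Pi.add_apply, mul_add]
  map_smul' c ξ := by
    ext b
    simp only [lp.coeFn_smul, Pi.smul_apply, smul_eq_mul, RingHom.id_apply]
    show w b * (c * ξ (σ b)) = c * (w b * ξ (σ b))
    ring

/-- **Weighted relabellings between `ℓ²` spaces are bounded**: for `|w| ≤ C` and `σ` injective on the
support of `w`, `(Tξ)(b) = w(b) ξ(σ b)` defines `T : ℓ²(α) → ℓ²(β)` with `‖T‖ ≤ C` (the two-index-type
version of `weightedShift`). [folklore] -/
def crossShift (hσ : InjOn σ {b | w b ≠ 0}) {C : ℝ} (hC : 0 ≤ C) (hw : ∀ b, ‖w b‖ ≤ C) :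
    lp (fun _ : α => ℂ) 2 →L[ℂ] lp (fun _ : β => ℂ) 2 :=
  LinearMap.mkContinuous (crossShiftₗ w σ hσ hw) C fun ξ => by
      refine lp.norm_le_of_tsum_le two_toReal_pos (by positivity) ?_
      have h := (tsum_sq_crossShift_le w σ hσ hw ξ).2
      simp only [ENNReal.toReal_ofNat, Real.rpow_two, mul_pow]
      exact h

/-- The action of a weighted relabelling on amplitudes. [folklore] -/
@[simp] theorem crossShift_apply (hσ : InjOn σ {b | w b ≠ 0}) {C : ℝ} (hC : 0 ≤ C)
    (hw : ∀ b, ‖w b‖ ≤ C) (ξ : lp (fun _ : α => ℂ) 2) (b : β) :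
    crossShift w σ hσ hC hw ξ b = w b * ξ (σ b) := rfl

/-- The norm bound of a weighted relabelling. [folklore] -/
theorem norm_crossShift_le (hσ : InjOn σ {b | w b ≠ 0}) {C : ℝ} (hC : 0 ≤ C) (hw : ∀ b, ‖w b‖ ≤ C) :
    ‖crossShift w σ hσ hC hw‖ ≤ C :=
  LinearMap.mkContinuous_norm_le _ hC _

/-- **Adjoint criterion for weighted relabellings** (as `weightedShift_eq_adjoint`, across index types).
[folklore] -/
theorem crossShift_eq_adjoint {w : β → ℂ} {σ : β → α} (hσ : InjOn σ {b | w b ≠ 0}) {C : ℝ} (hC : 0 ≤ C)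
    (hw : ∀ b, ‖w b‖ ≤ C) {w' : α → ℂ} {σ' : α → β} (hσ' : InjOn σ' {a | w' a ≠ 0}) {C' : ℝ} (hC' : 0 ≤ C')
    (hw' : ∀ a, ‖w' a‖ ≤ C')
    (h : ∀ b a, (w b ≠ 0 ∧ σ b = a) ↔ (w' a ≠ 0 ∧ σ' a = b))
    (hconj : ∀ b, w b ≠ 0 → w' (σ b) = conj (w b)) :
    crossShift w' σ' hσ' hC' hw' = ContinuousLinearMap.adjoint (crossShift w σ hσ hC hw) := by
  rw [ContinuousLinearMap.eq_adjoint_iff]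
  intro η ξ
  rw [lp.inner_eq_tsum, lp.inner_eq_tsum]
  simp only [crossShift_apply, RCLike.inner_apply']
  have hS : ∀ b, w b ≠ 0 → w' (σ b) ≠ 0 ∧ σ' (σ b) = b := fun b hb => (h b (σ b)).1 ⟨hb, rfl⟩
  have hS' : ∀ a, w' a ≠ 0 → w (σ' a) ≠ 0 ∧ σ (σ' a) = a := fun a ha => (h (σ' a) a).2 ⟨ha, rfl⟩
  let E : {b // w b ≠ 0} ≃ {a // w' a ≠ 0} :=
    { toFun := fun b => ⟨σ b, (hS b b.2).1⟩
      invFun := fun a => ⟨σ' a, (hS' a a.2).1⟩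
      left_inv := fun b => Subtype.ext (hS b b.2).2
      right_inv := fun a => Subtype.ext (hS' a a.2).2 }
  set f : α → ℂ := fun a => conj (w' a * η (σ' a)) * ξ a with hf
  set g : β → ℂ := fun b => conj (η b) * (w b * ξ (σ b)) with hg
  have hfsupp : support f ⊆ {a | w' a ≠ 0} := by
    intro a ha
    simp only [mem_support, hf] at ha
    intro h0; apply ha; rw [h0, zero_mul, map_zero, zero_mul]
  have hgsupp : support g ⊆ {b | w b ≠ 0} := by
    intro b hb
    simp only [mem_support, hg] at hb
    intro h0; apply hb; rw [h0, zero_mul, mul_zero]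
  calc ∑' a, f a = ∑' a : {a // w' a ≠ 0}, f a := (tsum_subtype_eq_of_support_subset hfsupp).symm
    _ = ∑' b : {b // w b ≠ 0}, f (E b) := (Equiv.tsum_eq E (fun a => f a)).symm
    _ = ∑' b : {b // w b ≠ 0}, g b := tsum_congr fun b => by
        simp only [hf, hg, E, Equiv.coe_fn_mk, (hS b b.2).2, hconj b b.2, map_mul, Complex.conj_conj]
        ring
    _ = ∑' b, g b := tsum_subtype_eq_of_support_subset hgsupp

end CrossShift

/-! ### The `N`-particle sector of the Fock space -/

section Sector

variable (ι)

/-- The sector of exactly `N` particles of the Fock space over `ι`: vectors supported on `|d| = N`.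
[cite: BoccatoEtAl2019Acta, §2 (`L²_s(Λ^N) ⊂ 𝓕`)] -/
def sectorFock (N : ℕ) : Submodule ℂ (FockSpace ι) where
  carrier := {ξ | ∀ d : ι →₀ ℕ, d.degree ≠ N → ξ d = 0}
  zero_mem' := fun _ _ => rfl
  add_mem' := by
    intro ξ η hξ hη d hd
    rw [lp.coeFn_add, Pi.add_apply, hξ d hd, hη d hd, add_zero]
  smul_mem' := by
    intro c ξ hξ d hd
    rw [lp.coeFn_smul, Pi.smul_apply, hξ d hd, smul_zero]

variable {ι}

/-- Membership in the `N`-particle sector. [folklore] -/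
theorem mem_sectorFock {ξ : FockSpace ι} : ξ ∈ sectorFock ι N ↔ ∀ d : ι →₀ ℕ, d.degree ≠ N → ξ d = 0 := Iff.rfl

/-- The `N`-particle sector lies in `𝓕^{≤N}`. [folklore] -/
theorem sectorFock_le_truncFock : sectorFock ι N ≤ truncFock ι N :=
  fun _ hξ d hd => hξ d (Nat.ne_of_gt hd)

/-- Basis vectors with `N` particles lie in the sector. [folklore] -/
theorem occBasis_mem_sectorFock [DecidableEq ι] {d : ι →₀ ℕ} (hd : d.degree = N) :
    occBasis d ∈ sectorFock ι N := fun e he =>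
  occBasis_apply_ne fun hed => by subst hed; exact he hd

/-- The sector lies in the closed span of its basis vectors `|d⟩`, `|d| = N`. [folklore] -/
theorem sectorFock_subset_closure_span [DecidableEq ι] :
    (sectorFock ι N : Set (FockSpace ι)) ⊆
      closure (Submodule.span ℂ (occBasis '' {d : ι →₀ ℕ | d.degree = N}) : Set (FockSpace ι)) := by
  intro ξ hξ
  have hsum := lp.hasSum_single ENNReal.ofNat_ne_top ξ
  refine mem_closure_of_tendsto hsum (Eventually.of_forall fun F => ?_)
  refine Submodule.sum_mem _ fun d _ => ?_
  by_cases hd : d.degree = N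
  · have : lp.single 2 d (ξ d : ℂ) = (ξ d : ℂ) • occBasis d := by
      rw [occBasis, ← lp.single_smul, smul_eq_mul, mul_one]
    rw [this]
    exact Submodule.smul_mem _ _ (Submodule.subset_span ⟨d, hd, rfl⟩)
  · rw [show (ξ d : ℂ) = 0 from hξ d hd]
    have : (lp.single 2 d (0 : ℂ) : FockSpace ι) = 0 := by
      refine lp.ext (funext fun e => ?_)
      rw [lp.single_apply, Pi.single_apply, lp.coeFn_zero, Pi.zero_apply]
      split_ifs <;> rfl
    rw [this]
    exact Submodule.zero_mem _

/-- **Two bounded operators that agree on the basis vectors `|d⟩`, `|d| = N`, agree on the sector.**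
[folklore] -/
theorem eqOn_sectorFock_of_eqOn_occBasis [DecidableEq ι] {F : Type*} [NormedAddCommGroup F]
    [NormedSpace ℂ F] {T S : FockSpace ι →L[ℂ] F}
    (h : ∀ d : ι →₀ ℕ, d.degree = N → T (occBasis d) = S (occBasis d)) :
    EqOn T S (sectorFock ι N) := by
  intro ξ hξ
  refine ContinuousLinearMap.eqOn_closure_span (s := occBasis '' {d : ι →₀ ℕ | d.degree = N}) ?_
    (sectorFock_subset_closure_span hξ)
  rintro v ⟨d, hd, rfl⟩
  exact h d hd

end Sector

/-! ### The excitation map `U_N` and its adjoint -/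

section Excitation

variable (z N)

/-- The weight of `U_N`: the indicator of `|dp| ≤ N`. [folklore] -/
def excWeight (dp : ExcMode z →₀ ℕ) : ℂ := if dp.degree ≤ N then 1 else 0

/-- `|excWeight| ≤ 1`. [folklore] -/
theorem norm_excWeight_le (dp : ExcMode z →₀ ℕ) : ‖excWeight z N dp‖ ≤ 1 := by
  unfold excWeight; split_ifs <;> simp

/-- The support of `excWeight` is `{|dp| ≤ N}`. [folklore] -/
theorem excWeight_ne_zero_iff {dp : ExcMode z →₀ ℕ} : excWeight z N dp ≠ 0 ↔ dp.degree ≤ N := by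
  unfold excWeight; split_ifs with h <;> simp [h]

/-- **The excitation map `U_N`** in the occupation basis: `(U_N ξ)(dp) = ξ(dp + (N - |dp|) e_z)` for
`|dp| ≤ N` (zero above `N`), a bounded operator `ℓ²(ι →₀ ℕ) → ℓ²(ι₊ →₀ ℕ)` of norm `≤ 1`.
[cite: BoccatoEtAl2019Acta, §1–2 (`U_N ψ_N = {α^{(0)}, …, α^{(N)}}`)] -/
def excitationMap : FockSpace ι →L[ℂ] FockSpace (ExcMode z) :=
  crossShift (excWeight z N) (liftConfig z N)
    (liftConfig_injOn.mono fun _ h => (excWeight_ne_zero_iff z N).1 h) zero_le_one (norm_excWeight_le z N)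

/-- The amplitudes of `U_N ξ`. [folklore] -/
theorem excitationMap_apply (ξ : FockSpace ι) (dp : ExcMode z →₀ ℕ) :
    excitationMap z N ξ dp = if dp.degree ≤ N then ξ (liftConfig z N dp) else 0 := by
  rw [excitationMap, crossShift_apply, excWeight]
  split_ifs <;> simp

/-- `U_N` maps into `𝓕_+^{≤N}`. [cite: BoccatoEtAl2019Acta, §2] -/
theorem excitationMap_mem_truncFock (ξ : FockSpace ι) : excitationMap z N ξ ∈ truncFock (ExcMode z) N :=
  fun dp hd => by rw [excitationMap_apply, if_neg (not_le.2 hd)]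

/-- The weight of `U_N^*`: the indicator of `|d| = N`. [folklore] -/
def excAdjWeight (d : ι →₀ ℕ) : ℂ := if d.degree = N then 1 else 0

/-- `|excAdjWeight| ≤ 1`. [folklore] -/
theorem norm_excAdjWeight_le (d : ι →₀ ℕ) : ‖excAdjWeight (ι := ι) N d‖ ≤ 1 := by
  unfold excAdjWeight; split_ifs <;> simp

/-- The support of `excAdjWeight` is `{|d| = N}`. [folklore] -/
theorem excAdjWeight_ne_zero_iff {d : ι →₀ ℕ} : excAdjWeight (ι := ι) N d ≠ 0 ↔ d.degree = N := by
  unfold excAdjWeight; split_ifs with h <;> simp [h]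

/-- **The adjoint `U_N^*`**: `(U_N^* η)(d) = η(d|_{ι₊})` for `|d| = N` (zero off the sector) —
`U_N^* {α^{(n)}} = ∑_n α^{(n)} ⊗_s φ_z^{⊗(N-n)}`. [cite: BoccatoEtAl2019Acta, §1–2] -/
def excitationMapAdj : FockSpace (ExcMode z) →L[ℂ] FockSpace ι :=
  crossShift (excAdjWeight (ι := ι) N) (dropConfig z)
    (dropConfig_injOn.mono fun _ h => (excAdjWeight_ne_zero_iff N).1 h) zero_le_one (norm_excAdjWeight_le N)

/-- The amplitudes of `U_N^* η`. [folklore] -/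
theorem excitationMapAdj_apply (η : FockSpace (ExcMode z)) (d : ι →₀ ℕ) :
    excitationMapAdj z N η d = if d.degree = N then η (dropConfig z d) else 0 := by
  rw [excitationMapAdj, crossShift_apply, excAdjWeight]
  split_ifs <;> simp

/-- `U_N^*` maps into the `N`-particle sector. [folklore] -/
theorem excitationMapAdj_mem_sectorFock (η : FockSpace (ExcMode z)) : excitationMapAdj z N η ∈ sectorFock ι N :=
  fun d hd => by rw [excitationMapAdj_apply, if_neg hd]

/-- **`U_N^*` is the Hilbert-space adjoint of `U_N`.** [cite: BoccatoEtAl2019Acta, §2] -/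
theorem excitationMapAdj_eq_adjoint :
    excitationMapAdj z N = ContinuousLinearMap.adjoint (excitationMap (ι := ι) z N) := by
  refine crossShift_eq_adjoint _ _ _ _ _ _ (fun dp d => ?_) (fun dp hdp => ?_)
  · rw [excWeight_ne_zero_iff, excAdjWeight_ne_zero_iff]
    constructor
    · rintro ⟨hdp, rfl⟩
      exact ⟨degree_liftConfig hdp, dropConfig_liftConfig dp⟩
    · rintro ⟨hd, rfl⟩
      exact ⟨degree_dropConfig_le hd, liftConfig_dropConfig hd⟩
  · rw [excWeight_ne_zero_iff] at hdp
    rw [excAdjWeight, excWeight, if_pos (degree_liftConfig hdp), if_pos hdp, map_one]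

/-- **`U_N^* U_N = 1` on the `N`-particle sector.** [cite: BoccatoEtAl2019Acta, §2 (`U_N` unitary)] -/
theorem excitationMapAdj_excitationMap {ξ : FockSpace ι} (hξ : ξ ∈ sectorFock ι N) :
    excitationMapAdj z N (excitationMap z N ξ) = ξ := by
  refine lp.ext (funext fun d => ?_)
  rw [excitationMapAdj_apply]
  by_cases hd : d.degree = N
  · rw [if_pos hd, excitationMap_apply, if_pos (degree_dropConfig_le hd), liftConfig_dropConfig hd]
  · rw [if_neg hd, hξ d hd]

/-- **`U_N U_N^* = 1` on `𝓕_+^{≤N}`.** [cite: BoccatoEtAl2019Acta, §2 (`U_N` unitary)] -/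
theorem excitationMap_excitationMapAdj {η : FockSpace (ExcMode z)} (hη : η ∈ truncFock (ExcMode z) N) :
    excitationMap z N (excitationMapAdj z N η) = η := by
  refine lp.ext (funext fun dp => ?_)
  rw [excitationMap_apply]
  by_cases hdp : dp.degree ≤ N
  · rw [if_pos hdp, excitationMapAdj_apply, if_pos (degree_liftConfig hdp), dropConfig_liftConfig]
  · rw [if_neg hdp, hη dp (not_le.1 hdp)]

/-- **`U_N` is isometric on the `N`-particle sector.** [cite: BoccatoEtAl2019Acta, §2 (`U_N` unitary)] -/
theorem norm_excitationMap_of_mem {ξ : FockSpace ι} (hξ : ξ ∈ sectorFock ι N) :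
    ‖excitationMap z N ξ‖ = ‖ξ‖ := by
  have h : ⟪excitationMap z N ξ, excitationMap z N ξ⟫_ℂ = ⟪ξ, ξ⟫_ℂ := by
    rw [← ContinuousLinearMap.adjoint_inner_right, ← excitationMapAdj_eq_adjoint,
      excitationMapAdj_excitationMap z N hξ]
  rw [inner_self_eq_norm_sq_to_K, inner_self_eq_norm_sq_to_K] at h
  have h' : ‖excitationMap z N ξ‖ ^ 2 = ‖ξ‖ ^ 2 := by exact_mod_cast h
  exact (sq_eq_sq₀ (norm_nonneg _) (norm_nonneg _)).1 h'

/-- **`U_N |d⟩ = |d|_{ι₊}⟩`** on basis vectors with `N` particles. [cite: BoccatoEtAl2019Acta, §1–2] -/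
theorem excitationMap_occBasis [DecidableEq ι] {d : ι →₀ ℕ} (hd : d.degree = N) :
    excitationMap z N (occBasis d) = occBasis (dropConfig z d) := by
  refine lp.ext (funext fun dp => ?_)
  rw [excitationMap_apply, occBasis_apply, occBasis_apply]
  by_cases hdp : dp.degree ≤ N
  · rw [if_pos hdp]
    by_cases h : liftConfig z N dp = d
    · rw [if_pos h, if_pos]; rw [← h, dropConfig_liftConfig]
    · rw [if_neg h, if_neg]; intro h'; apply h; rw [h', liftConfig_dropConfig hd]
  · rw [if_neg hdp, if_neg]
    intro h'; apply hdp; rw [h']; exact degree_dropConfig_le hd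

/-- **`U_N^* |dp⟩ = |dp + (N - |dp|) e_z⟩`** on basis vectors with at most `N` particles.
[cite: BoccatoEtAl2019Acta, §1–2] -/
theorem excitationMapAdj_occBasis [DecidableEq ι] {dp : ExcMode z →₀ ℕ} (hdp : dp.degree ≤ N) :
    excitationMapAdj z N (occBasis dp) = occBasis (liftConfig z N dp) := by
  refine lp.ext (funext fun d => ?_)
  rw [excitationMapAdj_apply, occBasis_apply, occBasis_apply]
  by_cases hd : d.degree = N
  · rw [if_pos hd]
    by_cases h : dropConfig z d = dp
    · rw [if_pos h, if_pos]; rw [← h, liftConfig_dropConfig hd]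
    · rw [if_neg h, if_neg]; intro h'; apply h; rw [h', dropConfig_liftConfig]
  · rw [if_neg hd, if_neg]
    intro h'; apply hd; rw [h']; exact degree_liftConfig hdp

end Excitation

/-! ### The rules (2.4): how `U_N` transforms the number-preserving bilinears -/

section Rules

variable (z N)

/-- `dropConfig` commutes with subtracting `e_q`, `q ≠ z`. [folklore] -/
theorem dropConfig_tsub_single (d : ι →₀ ℕ) (q : ExcMode z) :
    dropConfig z (d - Finsupp.single (q : ι) 1) = dropConfig z d - Finsupp.single q 1 := by
  ext r
  rw [dropConfig_apply, Finsupp.tsub_apply, Finsupp.tsub_apply, dropConfig_apply, ← dropConfig_single q 1,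
    dropConfig_apply]

/-- `dropConfig (d - e_q + e_p) = dropConfig d - e_q + e_p` for `p, q ≠ z`. [folklore] -/
theorem dropConfig_tsub_add (d : ι →₀ ℕ) (p q : ExcMode z) :
    dropConfig z (d - Finsupp.single (q : ι) 1 + Finsupp.single (p : ι) 1) =
      dropConfig z d - Finsupp.single q 1 + Finsupp.single p 1 := by
  rw [dropConfig_add, dropConfig_tsub_single, dropConfig_single]

/-- `dropConfig (d - e_z + e_p) = dropConfig d + e_p` for `p ≠ z`. [folklore] -/
theorem dropConfig_tsub_zero_add (d : ι →₀ ℕ) (p : ExcMode z) :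
    dropConfig z (d - Finsupp.single z 1 + Finsupp.single (p : ι) 1) = dropConfig z d + Finsupp.single p 1 := by
  rw [dropConfig_add, dropConfig_single]
  congr 1
  ext r
  rw [dropConfig_apply, Finsupp.tsub_apply, Finsupp.single_eq_of_ne r.2, tsub_zero, dropConfig_apply]

/-- `dropConfig (d - e_q + e_z) = dropConfig d - e_q` for `q ≠ z`. [folklore] -/
theorem dropConfig_tsub_add_zero (d : ι →₀ ℕ) (q : ExcMode z) :
    dropConfig z (d - Finsupp.single (q : ι) 1 + Finsupp.single z 1) = dropConfig z d - Finsupp.single q 1 := by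
  rw [dropConfig_add, dropConfig_tsub_single, dropConfig_single_zero, add_zero]

/-- The degree of the excitation part of an `N`-particle configuration: `|dropConfig d| = N - d z`. [folklore] -/
theorem degree_dropConfig {d : ι →₀ ℕ} (hd : d.degree = N) : (dropConfig z d).degree = N - d z := by
  have h := degree_dropConfig_add (z := z) d; omega

variable [DecidableEq ι]

/-- **Rule `U_N a_p^* a_q = a_p^* a_q U_N` (`p, q ≠ z`) on the `N`-particle sector.**
[cite: BoccatoEtAl2019Acta, (2.4)] -/
theorem excitationMap_crAnOp (p q : ExcMode z) :
    EqOn (excitationMap z N ∘L crAnOp N (p : ι) (q : ι)) (crAnOp N p q ∘L excitationMap z N) (sectorFock ι N) := by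
  refine eqOn_sectorFock_of_eqOn_occBasis fun d hd => ?_
  show excitationMap z N (crAnOp N (p : ι) (q : ι) (occBasis d)) = crAnOp N p q (excitationMap z N (occBasis d))
  rw [excitationMap_occBasis z N hd]
  by_cases hq : 1 ≤ d q
  · have hd' : (d - Finsupp.single (q : ι) 1 + Finsupp.single (p : ι) 1).degree = N := by
      rw [degree_add_single, degree_tsub_single hq]; have := hq.trans (apply_le_degree d q); omega
    rw [crAnOp_occBasis N (p : ι) (q : ι) hd.le hq, map_smul, excitationMap_occBasis z N hd',
      crAnOp_occBasis N p q (degree_dropConfig_le hd) (by rw [dropConfig_apply]; exact hq), ← dropConfig_tsub_add]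
    rfl
  · rw [not_le, Nat.lt_one_iff] at hq
    rw [crAnOp_occBasis_of_eq_zero N (p : ι) (q : ι) hq, map_zero,
      crAnOp_occBasis_of_eq_zero N p q (by rw [dropConfig_apply]; exact hq)]

/-- `√N · √(x/N) = √x`. [folklore] -/
theorem sqrt_mul_sqrt_div {Nr x : ℝ} (hN : 0 < Nr) : Real.sqrt Nr * Real.sqrt (x / Nr) = Real.sqrt x := by
  rw [← Real.sqrt_mul hN.le, mul_div_cancel₀ _ hN.ne']

/-- **Rule `U_N a_p^* a_z = √N b_p^* U_N` (`p ≠ z`) on the `N`-particle sector.**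
[cite: BoccatoEtAl2019Acta, (2.4)] -/
theorem excitationMap_crAnOp_zero_right (p : ExcMode z) :
    EqOn (excitationMap z N ∘L crAnOp N (p : ι) z)
      (((Real.sqrt N : ℝ) : ℂ) • (bCreate N p ∘L excitationMap z N)) (sectorFock ι N) := by
  refine eqOn_sectorFock_of_eqOn_occBasis (T := excitationMap z N ∘L crAnOp N (p : ι) z)
    (S := ((Real.sqrt N : ℝ) : ℂ) • (bCreate N p ∘L excitationMap z N)) fun d hd => ?_
  show excitationMap z N (crAnOp N (p : ι) z (occBasis d)) =
    ((Real.sqrt N : ℝ) : ℂ) • bCreate N p (excitationMap z N (occBasis d))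
  rw [excitationMap_occBasis z N hd]
  by_cases hz : 1 ≤ d z
  · have hdeg1 : 1 ≤ d.degree := hz.trans (apply_le_degree d z)
    have hNpos : (0 : ℝ) < N := by exact_mod_cast (hdeg1.trans_eq hd : 1 ≤ N)
    have hzN : d z ≤ N := (apply_le_degree d z).trans_eq hd
    have hd' : (d - Finsupp.single z 1 + Finsupp.single (p : ι) 1).degree = N := by
      rw [degree_add_single, degree_tsub_single hz]; omega
    have hlt : (dropConfig z d).degree < N := by rw [degree_dropConfig z N hd]; omega
    rw [crAnOp_occBasis N (p : ι) z hd.le hz, map_smul, excitationMap_occBasis z N hd',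
      bCreate_occBasis N p hlt, dropConfig_tsub_zero_add, smul_smul]
    congr 1
    rw [degree_dropConfig z N hd, dropConfig_apply]
    have e1 : ((d - Finsupp.single z 1 + Finsupp.single (p : ι) 1 : ι →₀ ℕ) (p : ι) : ℕ) = d p + 1 := by
      rw [Finsupp.add_apply, Finsupp.tsub_apply, Finsupp.single_eq_same, Finsupp.single_eq_of_ne p.2, tsub_zero]
    rw [e1, ← Complex.ofReal_mul]
    congr 1
    push_cast [Nat.cast_sub hzN]
    rw [show ((N : ℝ) - (N - d z)) = d z by ring, mul_left_comm, sqrt_mul_sqrt_div hNpos, mul_comm]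
  · rw [not_le, Nat.lt_one_iff] at hz
    have hdeg : N ≤ (dropConfig z d).degree := by rw [degree_dropConfig z N hd, hz, Nat.sub_zero]
    rw [crAnOp_occBasis_of_eq_zero N (p : ι) z hz, map_zero, bCreate_occBasis_of_le N p hdeg, smul_zero]

/-- **Rule `U_N a_z^* a_q = √N b_q U_N` (`q ≠ z`) on the `N`-particle sector.**
[cite: BoccatoEtAl2019Acta, (2.4)] -/
theorem excitationMap_crAnOp_zero_left (q : ExcMode z) :
    EqOn (excitationMap z N ∘L crAnOp N z (q : ι))
      (((Real.sqrt N : ℝ) : ℂ) • (bAnnih N q ∘L excitationMap z N)) (sectorFock ι N) := by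
  refine eqOn_sectorFock_of_eqOn_occBasis (T := excitationMap z N ∘L crAnOp N z (q : ι))
    (S := ((Real.sqrt N : ℝ) : ℂ) • (bAnnih N q ∘L excitationMap z N)) fun d hd => ?_
  show excitationMap z N (crAnOp N z (q : ι) (occBasis d)) =
    ((Real.sqrt N : ℝ) : ℂ) • bAnnih N q (excitationMap z N (occBasis d))
  rw [excitationMap_occBasis z N hd]
  by_cases hq : 1 ≤ d q
  · have hdeg1 : 1 ≤ d.degree := hq.trans (apply_le_degree d (q : ι))
    have hNpos : (0 : ℝ) < N := by exact_mod_cast (hdeg1.trans_eq hd : 1 ≤ N)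
    have hzN : d z ≤ N := (apply_le_degree d z).trans_eq hd
    have hd' : (d - Finsupp.single (q : ι) 1 + Finsupp.single z 1).degree = N := by
      rw [degree_add_single, degree_tsub_single hq]; omega
    rw [crAnOp_occBasis N z (q : ι) hd.le hq, map_smul, excitationMap_occBasis z N hd',
      bAnnih_occBasis N q (degree_dropConfig_le hd) (by rw [dropConfig_apply]; exact hq),
      dropConfig_tsub_add_zero, smul_smul]
    congr 1
    rw [degree_dropConfig z N hd, dropConfig_apply]
    have e1 : ((d - Finsupp.single (q : ι) 1 + Finsupp.single z 1 : ι →₀ ℕ) z : ℕ) = d z + 1 := by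
      rw [Finsupp.add_apply, Finsupp.tsub_apply, Finsupp.single_eq_same, Finsupp.single_eq_of_ne (Ne.symm q.2),
        tsub_zero]
    rw [e1, ← Complex.ofReal_mul]
    congr 1
    push_cast [Nat.cast_sub hzN]
    rw [show ((N : ℝ) + 1 - (N - d z)) = d z + 1 by ring, ← mul_assoc, sqrt_mul_sqrt_div hNpos]
  · rw [not_le, Nat.lt_one_iff] at hq
    rw [crAnOp_occBasis_of_eq_zero N z (q : ι) hq, map_zero,
      bAnnih_occBasis_of_eq_zero N q (by rw [dropConfig_apply]; exact hq), smul_zero]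

/-- **Rule `U_N a_z^* a_z = (N - 𝒩_+) U_N` on the `N`-particle sector.** [cite: BoccatoEtAl2019Acta, (2.4)] -/
theorem excitationMap_crAnOp_zero_zero :
    EqOn (excitationMap z N ∘L crAnOp N z z)
      ((N : ℂ) • excitationMap z N - numberCLM N ∘L excitationMap z N) (sectorFock ι N) := by
  refine eqOn_sectorFock_of_eqOn_occBasis (T := excitationMap z N ∘L crAnOp N z z)
    (S := (N : ℂ) • excitationMap z N - numberCLM N ∘L excitationMap z N) fun d hd => ?_
  show excitationMap z N (crAnOp N z z (occBasis d)) =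
    (N : ℂ) • excitationMap z N (occBasis d) - numberCLM N (excitationMap z N (occBasis d))
  rw [excitationMap_occBasis z N hd, numberCLM_occBasis N (degree_dropConfig_le hd), ← sub_smul,
    degree_dropConfig z N hd]
  have hzN : d z ≤ N := (apply_le_degree d z).trans_eq hd
  by_cases hz : 1 ≤ d z
  · rw [crAnOp_occBasis N z z hd.le hz, map_smul, tsub_single_add_single hz, excitationMap_occBasis z N hd]
    congr 1
    rw [Real.mul_self_sqrt (Nat.cast_nonneg _)]
    push_cast [Nat.cast_sub hzN]
    ring
  · rw [not_le, Nat.lt_one_iff] at hz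
    rw [crAnOp_occBasis_of_eq_zero N z z hz, map_zero, hz, Nat.sub_zero, sub_self, zero_smul]

end Rules

end Literature.MathematicalPhysics.QuantumManyBody.BoseGas.Fock
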